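/-
COR-CM (cell pub-hodgecm2, stage 2 of the Hodge ladder) — count-neutral KERNEL COMBINATORICS «the dihedral law», part Ib: the ARC PAIRS `A(a, b)` of the
dihedral datum `(G ⊃ ⟨g⟩, c = gⁿ, s)` of part Ia (`Census/DihedralDatum.lean`) (seat prover-pub-hodgecm2-b23-g48-0, binder prover b23, gen 48; claim «DIHEDRAL LAW»,
HOME/INBOX.md l.22267).  One bookkeeping definition (`arcPair`, on a private Finset `arcSet`) + theorems, on top of seat b09ʼs intrinsic model
(`CMF G c`, `rt`, `oflipCM`, `orb`: `CorCM/Prior/AllgGroup1.lean`, `Census/BlockParityLaw.lean`) used BY NAME; no `decide` beyond closed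
numerals, no certificate, no named fact, no `sorry`; `Interfaces.lean` (C1), every E term, B01, `Transposition/*`, `PortJoin/*`, `D2Bridge/*` untouched.
HONEST FRAMING: `HC_CM` is NOT proved, here or anywhere in the tree; nothing here is a period, a count of record or a headline.
T5: n/a-class (hypothesis binders are the fields of `Datum`: `gⁿ = c`, `orderOf g = 2n`, `[⟨g⟩ : G] = 2`, `s ∉ ⟨g⟩`, elements outside `⟨g⟩`
are involutions — inhabited by the dihedral group of order `4n`; checker: self).
-/
import Summits.HodgeConjecture.CorCM.Census.DihedralDatum

/-!
# The dihedral law, Ib: the arc pairs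

THE SETTING.  `G` a finite group, `g ∈ G` of order `2n` generating a subgroup of index two, `c = gⁿ` (a central involution), and every element
outside `⟨g⟩` an involution (`Datum`): `G` is the generalised dihedral group `D(ℤ/2n)` of order `4n` — the dihedral group `D_{2n}` with its central
rotation as complex conjugation (`D₈ = D(ℤ/8)`, `D₁₂ = D(ℤ/12)`, `D₁₆`, …).  Every element is a rotation `gⁱ` or a reflection `gⁱ·s`
(`exists_pow_or_pow_mul_s`), `s·gⁱ = g⁻ⁱ·s`.

An abstract CM type `Ψ : CMF G c` is read through two CM types of the cyclic group `ℤ/2n`: its ROTATION PART `{i ∣ gⁱ ∈ Ψ}` and its REFLECTION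
PART `{i ∣ gⁱ·s ∈ Ψ}` (= the rotation part of the base change `Ψ·s`, `mem_rt`).  The base change along `gᵏ` translates the two parts in OPPOSITE
directions, the base change along `s` SWAPS them.

(Part Ia, `Census/DihedralDatum.lean`: the datum lemmas and the arcs `z ∈ (a, a+n]` of `ℤ/2n`, written `(z − a − 1).val < n`.)
* §3 **THE ARC PAIRS** `arcPair D a b = {gⁱ ∣ i ∈ (a, a+n]} ⊔ {gⁱ·s ∣ i ∈ (b, b+n]}` — CM types (`a b : ℤ/2n`); membership of `gⁱ`, `gⁱ·s`;
  base changes **`A(a,b)·g⁻ᵏ = A(a − k, b + k)`** (`rt_pow_arcPair`), **`A(a,b)·s = A(b, a)`** (`rt_s_arcPair`), conjugation `A(a,b)·c = A(a+n, b+n)`;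
  so **`d = a + b ∈ ℤ/2n` is a block invariant** and `A(a,b) = A(a+b, 0)·g⁻ᵇ`: the arc pairs fall into the `2n` blocks `B_d ∋ A(d, 0)`;
  the parameters are determined by the type (`arcPair_injective`).
* §4 **the end-point flips**: flipping the place of `g^a` turns `A(a,b)` into `A(a−1, b)`, flipping the place of `g^b·s` turns it into `A(a, b−1)`
  — so the face at `A(a,b)` through these two places has corners `A(a−1,b)`, `A(a,b−1)`, `A(a−1,b−1)`: it LOWERS `d` by `1, 1, 2` (part III runs
  the descent `B_d → B_0 ∪ B_1`).

Parts II–IV (`Census/DihedralArcPairsHodge.lean`, `Census/DihedralDescent.lean`, `Census/DihedralLaw.lean`): Hodge vectors supported on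
`B_0 ∪ B_1` are sums of pairs; every type descends to arc pairs along seat b23 gen 38ʼs cyclic boundary descent run in both coordinates; hence
`β − 2` face orbits generate the Hodge lattice modulo pairs and `μ(D(ℤ/2n), gⁿ) = β − 2 = φ₂` for every `n ≥ 2`.

## References
* [Pohlmann1968] H. Pohlmann, Algebraic cycles on abelian varieties of complex multiplication type, Ann. of Math. 88 (1968), Thm 1.
* [Milne1999] J. S. Milne, Lefschetz motives and the Tate conjecture, Compositio Math. 117 (1999), Prop. 2.1, p. 54.
-/

namespace Summit.HodgeConjecture.CorCM.Census.Dihedral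

open Finset
open Summit.HodgeConjecture.CorCM.Prior.AllgGroup.RfwfAllgGroup
open Summit.HodgeConjecture.CorCM.Census.BlockParity

noncomputable section

variable {G : Type*} [Group G] [Fintype G] [DecidableEq G] {c : G} {n : ℕ} [NeZero n]
variable (D : Datum G c n)

/-! ## §3 The arc pairs -/

/-- The underlying set of the arc pair `A(a, b)`: rotations `g^{z.val}` over the arc at `a`, reflections `g^{z.val}·s` over the arc at `b`. -/
private def arcSet (a b : ZMod (2 * n)) : Finset G :=
  ((univ.filter fun z : ZMod (2 * n) => (z - a - 1).val < n).image fun z => D.g ^ z.val) ∪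
    ((univ.filter fun z : ZMod (2 * n) => (z - b - 1).val < n).image fun z => D.g ^ z.val * D.s)

omit [Fintype G] in
/-- Membership of a rotation in the arc set. -/
private theorem pow_mem_arcSet (a b : ZMod (2 * n)) (i : ℕ) :
    D.g ^ i ∈ arcSet D a b ↔ ((i : ZMod (2 * n)) - a - 1).val < n := by
  unfold arcSet
  rw [mem_union, mem_image, mem_image]
  constructor
  · rintro (⟨z, hz, h⟩ | ⟨z, _, h⟩)
    · rw [mem_filter] at hz
      have e : (i : ZMod (2 * n)) = z := by rw [← ZMod.natCast_zmod_val z, ← D.pow_eq_pow_iff, h]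
      rw [e]; exact hz.2
    · exact absurd h.symm (D.pow_ne_pow_mul_s i z.val)
  · intro h
    left
    refine ⟨(i : ZMod (2 * n)), by rw [mem_filter]; exact ⟨mem_univ _, h⟩, ?_⟩
    rw [D.pow_eq_pow_iff, ZMod.natCast_zmod_val]

omit [Fintype G] in
/-- Membership of a reflection in the arc set. -/
private theorem pow_mul_s_mem_arcSet (a b : ZMod (2 * n)) (i : ℕ) :
    D.g ^ i * D.s ∈ arcSet D a b ↔ ((i : ZMod (2 * n)) - b - 1).val < n := by
  unfold arcSet
  rw [mem_union, mem_image, mem_image]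
  constructor
  · rintro (⟨z, _, h⟩ | ⟨z, hz, h⟩)
    · exact absurd h (D.pow_ne_pow_mul_s z.val i)
    · rw [mem_filter] at hz
      have e : (i : ZMod (2 * n)) = z := by rw [← ZMod.natCast_zmod_val z, ← D.pow_mul_s_eq_iff, h]
      rw [e]; exact hz.2
  · intro h
    right
    refine ⟨(i : ZMod (2 * n)), by rw [mem_filter]; exact ⟨mem_univ _, h⟩, ?_⟩
    rw [D.pow_mul_s_eq_iff, ZMod.natCast_zmod_val]

omit [Fintype G] [DecidableEq G] [NeZero n] in
/-- `c·gⁱ = g^{n+i}`. [folklore] -/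
theorem c_mul_pow (i : ℕ) : c * D.g ^ i = D.g ^ (n + i) := by rw [pow_add, D.hgn]

omit [NeZero n] in
/-- The cast of `n + i` is `i + n`. -/
private theorem natCast_n_add (i : ℕ) : ((n + i : ℕ) : ZMod (2 * n)) = (i : ZMod (2 * n)) + n := by push_cast; ring

/-- **THE ARC PAIR `A(a, b)`** — the abstract CM type of `D(ℤ/2n)` whose rotation part is the arc `(a, a+n]` and whose reflection part is the
arc `(b, b+n]`. [folklore] -/
def arcPair (a b : ZMod (2 * n)) : CMF G c :=
  ⟨arcSet D a b, by
    intro x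
    obtain ⟨i, -, rfl | rfl⟩ := D.exists_pow_or_pow_mul_s x
    · rw [pow_mem_arcSet, c_mul_pow, pow_mem_arcSet, natCast_n_add, inArc_add_n (Nat.one_le_iff_ne_zero.mpr (NeZero.ne n))]
      tauto
    · rw [pow_mul_s_mem_arcSet, ← mul_assoc, c_mul_pow, pow_mul_s_mem_arcSet, natCast_n_add, inArc_add_n (Nat.one_le_iff_ne_zero.mpr (NeZero.ne n))]
      tauto⟩

/-- **Membership of a rotation**: `gⁱ ∈ A(a,b) ↔ i ∈ (a, a+n]`. [folklore] -/
theorem pow_mem_arcPair (a b : ZMod (2 * n)) (i : ℕ) : D.g ^ i ∈ (arcPair D a b).1 ↔ ((i : ZMod (2 * n)) - a - 1).val < n :=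
  pow_mem_arcSet D a b i

/-- **Membership of a reflection**: `gⁱ·s ∈ A(a,b) ↔ i ∈ (b, b+n]`. [folklore] -/
theorem pow_mul_s_mem_arcPair (a b : ZMod (2 * n)) (i : ℕ) : D.g ^ i * D.s ∈ (arcPair D a b).1 ↔ ((i : ZMod (2 * n)) - b - 1).val < n :=
  pow_mul_s_mem_arcSet D a b i

omit [NeZero n] in
/-- Two CM types agreeing on all rotations `gⁱ` and all reflections `gⁱ·s` (`i < 2n`) are equal. [folklore] -/
theorem eq_of_forall_mem_iff {Ψ Ψ' : CMF G c} (h1 : ∀ i : ℕ, i < 2 * n → (D.g ^ i ∈ Ψ.1 ↔ D.g ^ i ∈ Ψ'.1))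
    (h2 : ∀ i : ℕ, i < 2 * n → (D.g ^ i * D.s ∈ Ψ.1 ↔ D.g ^ i * D.s ∈ Ψ'.1)) : Ψ = Ψ' := by
  apply Subtype.ext
  ext x
  obtain ⟨i, hi, rfl | rfl⟩ := D.exists_pow_or_pow_mul_s x
  · exact h1 i hi
  · exact h2 i hi

/-- **Base change along a rotation**: `A(a,b)·g⁻ᵏ = A(a − k, b + k)` — the two parts move in opposite directions. [folklore] -/
theorem rt_pow_arcPair (a b : ZMod (2 * n)) (k : ℕ) :
    rt c (D.g ^ k) (arcPair D a b) = arcPair D (a - k) (b + k) := by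
  refine eq_of_forall_mem_iff D (fun i _ => ?_) (fun i _ => ?_)
  · rw [mem_rt, ← pow_add, pow_mem_arcPair, pow_mem_arcPair, inArc_sub_iff, Nat.cast_add]
  · rw [mem_rt, mul_assoc, D.s_mul_pow, ← mul_assoc, D.inv_pow_eq, ← pow_add, pow_mul_s_mem_arcPair, pow_mul_s_mem_arcPair,
      inArc_add_iff, Nat.cast_add, D.natCast_mul_pred, ← sub_eq_add_neg]

/-- **Base change along `s` swaps the two parts**: `A(a,b)·s = A(b, a)`. [folklore] -/
theorem rt_s_arcPair (a b : ZMod (2 * n)) : rt c D.s (arcPair D a b) = arcPair D b a := by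
  refine eq_of_forall_mem_iff D (fun i _ => ?_) (fun i _ => ?_)
  · rw [mem_rt, pow_mul_s_mem_arcPair, pow_mem_arcPair]
  · rw [mem_rt, mul_assoc, D.s_mul_s, mul_one, pow_mem_arcPair, pow_mul_s_mem_arcPair]

/-- Base change along a reflection `gᵏ·s`: `A(a,b)·(gᵏs)⁻¹ = A(b − k, a + k)`. [folklore] -/
theorem rt_pow_mul_s_arcPair (a b : ZMod (2 * n)) (k : ℕ) :
    rt c (D.g ^ k * D.s) (arcPair D a b) = arcPair D (b - k) (a + k) := by
  rw [rt_mul, rt_s_arcPair, rt_pow_arcPair]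

/-- **Conjugation**: `A(a,b)·c = A(a + n, b + n)`. [folklore] -/
theorem rt_c_arcPair (a b : ZMod (2 * n)) : rt c c (arcPair D a b) = arcPair D (a + n) (b + n) := by
  have e0 : rt c c (arcPair D a b) = rt c (D.g ^ n) (arcPair D a b) := by rw [D.hgn]
  rw [e0, rt_pow_arcPair]
  have e : (a - (n : ZMod (2 * n))) = a + n := by
    have h2 : (n : ZMod (2 * n)) + n = 0 := by
      rw [← Nat.cast_add, ← two_mul, ZMod.natCast_self]
    calc a - (n : ZMod (2 * n)) = a + n - (n + n) := by ring
      _ = a + n := by rw [h2, sub_zero]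
  rw [e]

/-- **Every arc pair is a rotation translate of `A(a + b, 0)`**: `A(a,b) = A(a+b, 0)·g^{-b.val}`. [folklore] -/
theorem arcPair_eq_rt (a b : ZMod (2 * n)) : arcPair D a b = rt c (D.g ^ b.val) (arcPair D (a + b) 0) := by
  rw [rt_pow_arcPair, ZMod.natCast_zmod_val, add_sub_cancel_right, zero_add]

/-- **The block invariant**: a base change of an arc pair is an arc pair with the same `d = a + b`. [folklore] -/
theorem rt_arcPair (a b : ZMod (2 * n)) (Q : G) : ∃ a' b' : ZMod (2 * n), a' + b' = a + b ∧ rt c Q (arcPair D a b) = arcPair D a' b' := by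
  obtain ⟨k, -, rfl | rfl⟩ := D.exists_pow_or_pow_mul_s Q
  · exact ⟨a - k, b + k, by ring, rt_pow_arcPair D a b k⟩
  · exact ⟨b - k, a + k, by ring, rt_pow_mul_s_arcPair D a b k⟩

omit [NeZero n] in
/-- `u + 1` lies in the arc at `u'` iff `(u − u').val < n`. [folklore] -/
theorem inArc_add_one_iff (u u' : ZMod (2 * n)) : ((u + 1) - u' - 1).val < n ↔ (u - u').val < n := by
  rw [show u + 1 - u' - 1 = u - u' by ring]

/-- An arc determines its starting point. [folklore] -/
theorem eq_of_forall_inArc_iff {u u' : ZMod (2 * n)} (h : ∀ z : ZMod (2 * n), (z - u - 1).val < n ↔ (z - u' - 1).val < n) : u = u' := by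
  have hn : 1 ≤ n := Nat.one_le_iff_ne_zero.mpr (NeZero.ne n)
  have h1 : (u - u').val < n := (inArc_add_one_iff u u').mp ((h _).mp (by
    rw [inArc_add_one_iff, sub_self, ZMod.val_zero]; omega))
  have h2 : (u' - u).val < n := (inArc_add_one_iff u' u).mp ((h _).mpr (by
    rw [inArc_add_one_iff, sub_self, ZMod.val_zero]; omega))
  by_contra hne
  have hx : u - u' ≠ 0 := sub_ne_zero.mpr hne
  have hv : (u - u').val ≠ 0 := fun h0 => hx ((ZMod.val_eq_zero _).mp h0)
  have hlt := ZMod.val_lt (u - u')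
  rw [show u' - u = -(u - u') by ring, ZMod.neg_val', Nat.mod_eq_of_lt (by omega)] at h2
  omega

/-- **The parameters are determined by the arc pair**: `A(a,b) = A(a',b') → a = a' ∧ b = b'`. [folklore] -/
theorem arcPair_injective {a b a' b' : ZMod (2 * n)} (h : arcPair D a b = arcPair D a' b') : a = a' ∧ b = b' := by
  constructor
  · apply eq_of_forall_inArc_iff
    intro z
    rw [← ZMod.natCast_zmod_val z, ← pow_mem_arcPair D a b, ← pow_mem_arcPair D a' b', h]
  · apply eq_of_forall_inArc_iff
    intro z
    rw [← ZMod.natCast_zmod_val z, ← pow_mul_s_mem_arcPair D a b, ← pow_mul_s_mem_arcPair D a' b', h]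

/-- The invariant `d` is well defined on arc pairs: equal arc pairs have equal `a + b`. [folklore] -/
theorem add_eq_of_arcPair_eq {a b a' b' : ZMod (2 * n)} (h : arcPair D a b = arcPair D a' b') : a + b = a' + b' := by
  obtain ⟨h1, h2⟩ := arcPair_injective D h
  rw [h1, h2]

/-- **Distinct `d` ⟹ distinct blocks**: if a base change of `A(a,b)` equals `A(a',b')` then `a + b = a' + b'`. [folklore] -/
theorem add_eq_of_rt_eq {a b a' b' : ZMod (2 * n)} {Q : G} (h : rt c Q (arcPair D a b) = arcPair D a' b') : a + b = a' + b' := by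
  obtain ⟨a₁, b₁, hsum, h₁⟩ := rt_arcPair D a b Q
  rw [h₁] at h
  rw [← hsum, add_eq_of_arcPair_eq D h]

/-! ## §4 The end-point flips of an arc pair -/

omit [Fintype G] [NeZero n] in
/-- The place of the rotation `g^j`: `gⁱ ∈ {gʲ, c·gʲ}` iff `i = j` or `i = j + n` in `ℤ/2n`. [folklore] -/
theorem pow_mem_orb_pow_iff (i j : ℕ) :
    D.g ^ i ∈ orb c (D.g ^ j) ↔ ((i : ZMod (2 * n)) = j ∨ (i : ZMod (2 * n)) = j + n) := by
  rw [mem_orb, c_mul_pow, D.pow_eq_pow_iff, D.pow_eq_pow_iff, natCast_n_add]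

omit [Fintype G] [NeZero n] in
/-- A reflection is not in the place of a rotation. [folklore] -/
theorem pow_mul_s_notMem_orb_pow (i j : ℕ) : D.g ^ i * D.s ∉ orb c (D.g ^ j) := by
  rw [mem_orb, c_mul_pow]
  rintro (h | h)
  · exact D.pow_ne_pow_mul_s j i h.symm
  · exact D.pow_ne_pow_mul_s (n + j) i h.symm

omit [Fintype G] [NeZero n] in
/-- A rotation is not in the place of a reflection. [folklore] -/
theorem pow_notMem_orb_pow_mul_s (i j : ℕ) : D.g ^ i ∉ orb c (D.g ^ j * D.s) := by
  rw [mem_orb, ← mul_assoc, c_mul_pow]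
  rintro (h | h)
  · exact D.pow_ne_pow_mul_s i j h
  · exact D.pow_ne_pow_mul_s i (n + j) h

omit [Fintype G] [NeZero n] in
/-- The place of the reflection `gʲ·s`: `gⁱ·s ∈ {gʲs, c·gʲs}` iff `i = j` or `i = j + n` in `ℤ/2n`. [folklore] -/
theorem pow_mul_s_mem_orb_iff (i j : ℕ) :
    D.g ^ i * D.s ∈ orb c (D.g ^ j * D.s) ↔ ((i : ZMod (2 * n)) = j ∨ (i : ZMod (2 * n)) = j + n) := by
  rw [mem_orb, ← mul_assoc, c_mul_pow, D.pow_mul_s_eq_iff, D.pow_mul_s_eq_iff, natCast_n_add]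

/-- The end-point toggle for arcs: `z ∈ (a−1, a−1+n]` iff NOT (`z ∈ (a, a+n]` ↔ `z ∈ {a, a+n}`). [folklore] -/
theorem inArc_sub_one_iff (a z : ZMod (2 * n)) :
    (z - (a - 1) - 1).val < n ↔ ¬ ((z - a - 1).val < n ↔ (z = a ∨ z = a + n)) := by
  have h := val_lt_iff_not_iff (Nat.one_le_iff_ne_zero.mpr (NeZero.ne n)) (z - a)
  rw [show z - (a - 1) - 1 = z - a by ring]
  have e1 : z = a ↔ z - a = 0 := by rw [sub_eq_zero]
  have e2 : z = a + n ↔ z - a = (n : ZMod (2 * n)) := by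
    constructor
    · intro hz; rw [hz]; ring
    · intro hz; rw [← hz]; ring
  rw [e1, e2]
  exact h

/-- **Flipping the place of `g^a` lowers the rotation parameter**: `A(a,b)^{(g^a)} = A(a − 1, b)`. [folklore] -/
theorem oflipCM_pow_arcPair (hc2 : c * c = 1) (a b : ZMod (2 * n)) :
    oflipCM c hc2 (D.g ^ a.val) (arcPair D a b) = arcPair D (a - 1) b := by
  refine eq_of_forall_mem_iff D (fun i _ => ?_) (fun i _ => ?_)
  · rw [CyclicFaces.mem_oflipCM_iff, pow_mem_arcPair, pow_mem_arcPair, pow_mem_orb_pow_iff, ZMod.natCast_zmod_val, inArc_sub_one_iff]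
  · rw [CyclicFaces.mem_oflipCM_iff, pow_mul_s_mem_arcPair, pow_mul_s_mem_arcPair]
    have h := pow_mul_s_notMem_orb_pow D i a.val
    tauto

/-- **Flipping the place of `g^b·s` lowers the reflection parameter**: `A(a,b)^{(g^b s)} = A(a, b − 1)`. [folklore] -/
theorem oflipCM_pow_mul_s_arcPair (hc2 : c * c = 1) (a b : ZMod (2 * n)) :
    oflipCM c hc2 (D.g ^ b.val * D.s) (arcPair D a b) = arcPair D a (b - 1) := by
  refine eq_of_forall_mem_iff D (fun i _ => ?_) (fun i _ => ?_)
  · rw [CyclicFaces.mem_oflipCM_iff, pow_mem_arcPair, pow_mem_arcPair]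
    have h := pow_notMem_orb_pow_mul_s D i b.val
    tauto
  · rw [CyclicFaces.mem_oflipCM_iff, pow_mul_s_mem_arcPair, pow_mul_s_mem_arcPair, pow_mul_s_mem_orb_iff, ZMod.natCast_zmod_val,
      inArc_sub_one_iff]

/-- **The double end-point flip**: `A(a,b)` flipped at both end places is `A(a − 1, b − 1)`. [folklore] -/
theorem oflipCM_oflipCM_arcPair (hc2 : c * c = 1) (a b : ZMod (2 * n)) :
    oflipCM c hc2 (D.g ^ a.val) (oflipCM c hc2 (D.g ^ b.val * D.s) (arcPair D a b)) = arcPair D (a - 1) (b - 1) := by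
  rw [oflipCM_pow_mul_s_arcPair, oflipCM_pow_arcPair]

/-- **THE ARC FACE** at `A(a,b)` through the places of `g^a` and `g^b·s`:
`[A(a,b)] + [A(a−1,b−1)] − [A(a−1,b)] − [A(a,b−1)]`. [folklore] -/
theorem gface_arcPair (hc2 : c * c = 1) (a b : ZMod (2 * n)) :
    gface c hc2 (arcPair D a b) (D.g ^ a.val) (D.g ^ b.val * D.s) =
      Finsupp.single (arcPair D a b) 1 + Finsupp.single (arcPair D (a - 1) (b - 1)) 1
        - Finsupp.single (arcPair D (a - 1) b) 1 - Finsupp.single (arcPair D a (b - 1)) 1 := by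
  unfold gface
  rw [oflipCM_oflipCM_arcPair, oflipCM_pow_arcPair, oflipCM_pow_mul_s_arcPair]

/-- The arc face is a face relation (its two places are distinct). [folklore] -/
theorem gface_arcPair_mem_gfaceSet (hc2 : c * c = 1) (a b : ZMod (2 * n)) :
    gface c hc2 (arcPair D a b) (D.g ^ a.val) (D.g ^ b.val * D.s) ∈ gfaceSet G c hc2 :=
  ⟨arcPair D a b, D.g ^ a.val, D.g ^ b.val * D.s, pow_mul_s_notMem_orb_pow D b.val a.val, rfl⟩

end

end Summit.HodgeConjecture.CorCM.Census.Dihedral
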